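import Summits.MatrixMultiplication.OmegaCensus.STPPKernelListerOrderN51DP1

/-!
# ω-census (abelian STPP census): kernel lister — ORDER capstone at `n = 51` MODULO the 15 tree-law survivor pattern(s) (part 7 of 10: root computation over `selN51P7`)

HONEST FRAMING (pub-omega census; verbatim): lottery ticket; floor = certified bounds/negative ranges.
Census STRUCTURE (seat pub-omega-stpp-2 gen 30, 2026-08-29), family (b2).  Nothing here is progress on `ω`.  CONDITIONAL THEOREM: for every
finite abelian group `H` of order `51`, IF none of the 15 size patterns of `deadN51` (`234_235`, `234_325`, `333_333`, `111_234_333`, `114_342_342`, `122_324_324`, `224_233_233`, `224_233_323`, `224_233_332`, `224_332_332`, `233_233_233`, `233_233_323`, `233_323_332`, `112_121_324_324`, `112_242_332_422`) is realisable in `H` as an STPP family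
(CKSU Def. 5.1), THEN every STPP family of `H` has `Σ |Aᵢ||Bᵢ||Cᵢ| ≤ 51` (no beating family, no `ω < 3` via CKSU Thm. 5.5).  The dead list is
EXACTLY the set of minimal beating size patterns (canonical classes, all block counts, all entries) that survive the seven tree laws of the kernel
lister at order `51` (single-block volume, representation count, N7, N16, N8 = Kneser over all divisors, N18, N12) — i.e. the residual census
obligation at order `51` is reduced to deciding these 15 explicit patterns per group (by search engines or future kernel kills).  Mechanism:
`KLister.volume_le_of_scan_list_dead` (`STPPKernelListerOrderKitD`) over the root computation with this dead list, split over 10 first-block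
selection(s) (`decide +kernel`; python twin `gen_orderD.py`/`klister_lean.py`, 1115253 calls, canonical-equality dead test, fixpoint in 2 round(s)).
-/

open Finset

namespace Summit.MatrixMultiplication.OmegaCensus.KLister

open Literature.Computability.AlgebraicComplexity


/-- First blocks of part 7 of the root computation at order `51`. [folklore] -/
def selN51P7 : List Shape := [(3, 2, 3), (3, 3, 2)]

set_option maxRecDepth 32768 in
set_option maxHeartbeats 4000000 in
/-- Root computation of the kernel lister at order `51` with the dead list `deadN51`, first blocks in `selN51P7`: `true` (twin 116144 calls). [folklore] -/
theorem scan_N51P7 : scanFirstC 51 deadN51 (fun s => selN51P7.contains s) chunksN51 = true := by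
  decide +kernel

end Summit.MatrixMultiplication.OmegaCensus.KLister
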